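import Literature.Computability.AlgebraicComplexity.CwCubeKoszulCertBlocks
import Literature.Computability.AlgebraicComplexity.CwCubeKoszulCertMain
import Literature.Computability.AlgebraicComplexity.BorderRankCWThm12
import Literature.Computability.AlgebraicComplexity.CwSquareGenericRank
import Literature.Computability.AlgebraicComplexity.BorderRankCWKoszulPowerQ2Proofs
import HarnessLib

/-!
# CGLV 2022, Thm. 1.2, cube case (`CGLV2022_thm12_cube`) — PROVED; hence Thm. 1.2 and Cor. 3.5 in full

Topic: `Literature/Computability/AlgebraicComplexity`.  Discharge of the named fact
`CGLV2022_thm12_cube` of `BorderRankCW.lean` (Conner–Gesmundo–Landsberg–Ventura, *Rank and border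
rank of Kronecker powers of tensors and Strassen's laser method*, comput. complexity 31 (2022) =
arXiv:1909.04785v2, Thm. 1.2, second paragraph):

  "For all `q > 4`, `bR(T_{cw,q}^{⊠3}) = (q+2)³`; if `q = 3, 4` then `bR(T_{cw,q}^{⊠3}) ≥ (q+2)²(q+1)`;
   if `q = 2` then `bR(T_{cw,2}^{⊠3}) ≥ 15·3`."

The source proves the lower bound for `q > 4` by Thm. 3.4: the `p = 2` Koszul flattening of
`φ₃(T_{cw,q}^{⊠3})` has rank `6(q+2)³`, computed by an `𝔖_{q-4}^{×3}`-isotypic decomposition and a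
computer calculation (§§3.3–3.5, 6).  The proof assembled here is `q`-uniform and kernel-checked:

1. `CwCubeDeadLabels.lean` — with the restriction `φ₃|₅` of the labels `≤ 5` EXTENDED BY ZERO to the
   labels `≤ q` (`extendPhi 5 q (cglvPhi3 _ 5)`; the labels `6, …, q` are dead), the flattening is
   exactly block diagonal by dead pattern and every block is a frozen submatrix of the single
   `q = 5` matrix `K₅`; hence `rank ≥ r_∅ + (q-5)(r_0+r_1+r_2) + (q-5)²(r_01+r_02+r_12) + (q-5)³ r_012`
   (`cube_blockRank_le_rank_koszulFlattening_extendPhi`);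
2. `CwCubeKoszulCert*.lean` — the eight ranks are at least `2058; 294, 294, 294; 42, 42, 42; 6`
   (kernel-checked LU certificates, `PackedRowLUCertificate.lean`), so that
   `rank ≥ 2058 + 882(q-5) + 126(q-5)² + 6(q-5)³ = 6(q+2)³` — CGLV's own count in the proof of
   Thm. 3.4, with the dead labels in place of the standard representation `V`, `dim V = q - 5`;
3. the Koszul bound `rank ≤ C(4,2)·bR` (`le_algBorderRank_of_lt_rank_koszulFlattening`) gives
   `bR ≥ (q+2)³`, and submultiplicativity the equality (`algBorderRank_kroneckerPow_cwTensor_le`);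
4. `q = 3, 4` by propagation (CGLV Prop. 3.2) from the certified square ranks `150`, `72`, and
   `q = 2` from the certified rank `265` — all already in the tree (`BorderRankCWThm12.lean`).

* `rank_koszulFlattening_extendPhi_cube_ge` — `6(q+2)³ ≤ rank` for `q ≥ 5`;
* `cube_le_algBorderRank` — `(q+2)³ ≤ bR(T_{cw,q}^{⊠3})` for `q > 4`, unconditionally;
* `CGLV2022_thm12_cube_holds` — the discharge;
* `CGLV2022_cor35_holds` — Cor. 3.5 (both clauses) unconditionally (Prop. 3.2 with `T₁ = T_{cw,q}^{⊠3}`);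
* `CGLV2022_thm12_power_holds` — Thm. 1.2 (iii) (`CGLV2022_thm12_power`), with the `q = 2` clause
  from `CGLV2022_thm12_power_q2_holds` (`BorderRankCWKoszulPowerQ2Proofs.lean`);
* `CGLV2022_thm12_holds` — **the whole of CGLV Thm. 1.2** (`CGLV2022_thm12 = square ∧ cube ∧ power`),
  the square part being `CGLV2022_thm12_square_holds` (`CwSquareGenericRank.lean`).

## References

* A. Conner, F. Gesmundo, J. M. Landsberg, E. Ventura, *Rank and border rank of Kronecker powers of
  tensors and Strassen's laser method*, comput. complexity 31 (2022), Thm. 1.2, Prop. 3.2, Thm. 3.4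
  and its proof, Cor. 3.5, §6; doi:10.1007/s00037-021-00217-y, arXiv:1909.04785v2.
  [ConnerGesmundoLandsbergVentura2022]
-/

noncomputable section

namespace Literature.Computability.AlgebraicComplexity

/-- **The flattening rank, uniformly in `q ≥ 5`**: the `p = 2` Koszul flattening of
`T_{cw,q}^{⊠3}` after the dead-label restriction `extendPhi 5 q (φ₃|₅)` has rank at least
`6(q+2)³` (`= 2058 + 882(q-5) + 126(q-5)² + 6(q-5)³`).
[cite: ConnerGesmundoLandsbergVentura2022, Thm. 3.4 (proof)] -/
theorem rank_koszulFlattening_extendPhi_cube_ge {q : ℕ} (hq : 5 ≤ q) :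
    6 * (q + 2) ^ 3 ≤
      (koszulFlattening 2 (extendPhi ℂ 5 q (cglvPhi3 ℂ 5)).mulVecLin
        (kroneckerPow (cwTensor ℂ q) 3)).rank := by
  have key := cube_blockRank_le_rank_koszulFlattening_extendPhi (K := ℂ) 2 (by norm_num) hq
    (cglvPhi3 ℂ 5)
  refine le_trans ?_ key
  obtain ⟨d, rfl⟩ : ∃ d, q = d + 5 := ⟨q - 5, by omega⟩
  rw [Nat.add_sub_cancel]
  have h0 := K5.blockRank_E_ge
  have h1 := K5.blockRank_F0_ge
  have h2 := K5.blockRank_F1_ge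
  have h3 := K5.blockRank_F2_ge
  have h4 := K5.blockRank_F01_ge
  have h5 := K5.blockRank_F02_ge
  have h6 := K5.blockRank_F12_ge
  have h7 := K5.blockRank_F012_ge
  calc 6 * (d + 5 + 2) ^ 3 = 2058 + d * 882 + d ^ 2 * 126 + d ^ 3 * 6 := by ring
    _ ≤ _ := by
      refine Nat.add_le_add (Nat.add_le_add (Nat.add_le_add h0 (Nat.mul_le_mul_left _ ?_))
        (Nat.mul_le_mul_left _ ?_)) (Nat.mul_le_mul_left _ h7) <;> omega

/-- **`(q+2)³ ≤ bR(T_{cw,q}^{⊠3})` for `q > 4`**, unconditionally (Koszul bound: `6((q+2)³ - 1) <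
`6(q+2)³ ≤ rank`). [cite: ConnerGesmundoLandsbergVentura2022, Thm. 1.2 / Thm. 3.4] -/
theorem cube_le_algBorderRank {q : ℕ} (hq : 4 < q) :
    (q + 2) ^ 3 ≤ algBorderRank (kroneckerPow (cwTensor ℂ q) 3) := by
  refine le_algBorderRank_of_lt_rank_koszulFlattening 2 (extendPhi ℂ 5 q (cglvPhi3 ℂ 5)) _ ?_
  have h := rank_koszulFlattening_extendPhi_cube_ge (q := q) (by omega)
  rw [(by decide : Nat.choose (2 * 2) 2 = 6)]
  have : 1 ≤ (q + 2) ^ 3 := Nat.one_le_pow _ _ (by omega)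
  generalize (q + 2) ^ 3 = s at *
  omega

/-- **CGLV 2022, Thm. 1.2, cube case — PROVED.** `bR(T_{cw,q}^{⊠3}) = (q+2)³` for `q > 4`;
`≥ (q+2)²(q+1)` for `q = 3, 4`; `≥ 15·3` for `q = 2`. [cite: ConnerGesmundoLandsbergVentura2022, Thm. 1.2] -/
theorem CGLV2022_thm12_cube_holds : CGLV2022_thm12_cube := by
  refine ⟨fun q hq => le_antisymm (algBorderRank_kroneckerPow_cwTensor_le ℂ q 3)
    (cube_le_algBorderRank hq), ?_, le_algBorderRank_cwTensor_two_cube⟩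
  rintro q (rfl | rfl)
  · simpa using CGLV2022_thm12_power_three_of_koszulRank CGLV2022_koszulRank_sq_three_holds 3
      (by norm_num)
  · simpa using CGLV2022_thm12_power_four_of_koszulRank CGLV2022_thm33_koszulRank_q4_holds 3
      (by norm_num)

/-- **Thm. 1.2 (iii) for `q > 4`, unconditionally**: `(q+1)^{N-3}(q+2)³ ≤ bR(T_{cw,q}^{⊠N})` for
`N ≥ 3` (CGLV, proof of Cor. 3.5: Prop. 3.2 with `T₁ = T_{cw,q}^{⊠3}` and the `1_A`-generic
`T₂ = T_{cw,q}^{⊠(N-3)}`, here with the dead-label flattening of `T₁`).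
[cite: ConnerGesmundoLandsbergVentura2022, Cor. 3.5 (proof)] -/
theorem CGLV2022_thm12_power_ge5 (q N : ℕ) (hq : 4 < q) (hN : 3 ≤ N) :
    (q + 1) ^ (N - 3) * (q + 2) ^ 3 ≤ algBorderRank (kroneckerPow (cwTensor ℂ q) N) := by
  have hα := isUnit_contractFirst_cwCovector (K := ℂ) (q := q) (by omega)
  have key := rank_koszulFlattening_mul_pow_le_algBorderRank_kroneckerPow (cwTensor ℂ q) hα 2 3
    (N - 3) N (by omega) (extendPhi ℂ 5 q (cglvPhi3 ℂ 5)).mulVecLin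
  rw [Fintype.card_fin, show Nat.choose (2 * 2) 2 = 6 by decide] at key
  have h := rank_koszulFlattening_extendPhi_cube_ge (q := q) (by omega)
  have key' := (Nat.mul_le_mul_right ((q + 1) ^ (N - 3)) h).trans key
  have e : 6 * ((q + 1) ^ (N - 3) * (q + 2) ^ 3) = 6 * (q + 2) ^ 3 * (q + 1) ^ (N - 3) := by ring
  exact Nat.le_of_mul_le_mul_left (e ▸ key') (by norm_num)

/-- **CGLV 2022, Cor. 3.5 — PROVED** (both clauses; the `q = 4` clause from the certified base case
`q = 4` of Thm. 3.3). [cite: ConnerGesmundoLandsbergVentura2022, Cor. 3.5] -/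
theorem CGLV2022_cor35_holds : CGLV2022_cor35 :=
  ⟨fun q N hq hN => CGLV2022_thm12_power_ge5 q N hq hN,
    fun N hN => CGLV2022_thm12_power_four_of_koszulRank CGLV2022_thm33_koszulRank_q4_holds N hN⟩

/-- **CGLV 2022, Thm. 1.2 (iii) — PROVED** (`CGLV2022_thm12_power`): `q > 4` by the dead-label
cube flattening and Prop. 3.2, `q = 3, 4` by propagation from the certified square ranks, `q = 2` by
`CGLV2022_thm12_power_q2_holds`. [cite: ConnerGesmundoLandsbergVentura2022, Thm. 1.2 (iii)] -/
theorem CGLV2022_thm12_power_holds : CGLV2022_thm12_power := by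
  refine ⟨fun q N hq hN => CGLV2022_thm12_power_ge5 q N hq hN, ?_, CGLV2022_thm12_power_q2_holds⟩
  rintro q N (rfl | rfl) hN
  · simpa using CGLV2022_thm12_power_three_of_koszulRank CGLV2022_koszulRank_sq_three_holds N hN
  · simpa using CGLV2022_thm12_power_four_of_koszulRank CGLV2022_thm33_koszulRank_q4_holds N hN

/-- **CGLV 2022, Thm. 1.2 — PROVED in full** (`CGLV2022_thm12 = square ∧ cube ∧ power`; answering
Bläser 2013, Problem 9.8, as the source puts it). [cite: ConnerGesmundoLandsbergVentura2022, Thm. 1.2] -/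
theorem CGLV2022_thm12_holds : CGLV2022_thm12 :=
  ⟨CGLV2022_thm12_square_holds, CGLV2022_thm12_cube_holds, CGLV2022_thm12_power_holds⟩

end Literature.Computability.AlgebraicComplexity

end
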